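import Summits.ResolutionOfSingularities.ResolutionOfSingularities.Theorems.PurelyInseparableDim4E2OfCJSSetting
import Summits.ResolutionOfSingularities.ResolutionOfSingularities.Theorems.PurelyInseparableDim4SymbolicPower
import Summits.ResolutionOfSingularities.ResolutionOfSingularities.Theorems.HilbertSamuelEliminationSigmaMaxModificationsCorridor3WLadderLocalChainsLocal
import Summits.ResolutionOfSingularities.ResolutionOfSingularities.Theorems.HilbertSamuelEliminationSigmaMaxModificationsCorridor3WLadderAlgIsolatedHypersurface
import Literature.AlgebraicGeometry.Resolution.CoefficientDerivations
import Mathlib.RingTheory.Localization.LocalizationLocalization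
import HarnessLib

/-!
# F4-I(3,3) from CJS — ROW (I) `E2OfCJS.IsolationRow` DISCHARGED: the closed point of a local scheme presented by
# `z³ + F`, `F` with an ISOLATED `3`-fold point, is isolated in its Hilbert–Samuel locus (cell `res-dim4-pi`)

[OURS · counted 0 · AI work weaker than expert review.]  Cell `res-dim4-pi` (D-0157 DOOR 2), seat `res-dim4-p-11` g2
(row (I) hand of record, desk WORD #59 (a); row holder res-dim4-p-2 g2; K res-dim4-p-9 g2).  NOTHING here proves
`NoIsolatedTrap 3 3`, the Cossart–Jannsen–Saito theorem, or resolution of singularities in dimension ≥ 4 /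
characteristic `p`.  What is proved is ONE of the five OURS sub-rows of the transfer row of
`…E2OfCJSRows` (p663940): **`theorem E2OfCJS.isolationRow : E2OfCJS.IsolationRow`**.

## The argument

Let `(S, s)` be LOCAL (`IsLocalAt S s`) and PRESENTED by `F` over `L` (`𝒪_{S,s} ≅ HypStalk L F ≅ R ⧸ (g₀)`,
`R = 𝒪_{𝔸⁵_L,0}`, `g₀` the germ of `g = z³ + F`; res-dim4-p-2 g2's `hypStalkEquivQuot`, p664844), `ordZero F = 3`,
`IsIsolated 3 F`.

* §1 ORDER PROFILE ⇒ ISOLATION (generic, any locally Noetherian scheme): if every point `y` has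
  `H^N_X(y) = hypersurfaceHFe (N+1) (m y)` with `m y ≤ m x` and `m y = m x ⇒ y = x`, then `x` is isolated in `X_max`
  (indeed `X_max = {x}`; the hypersurface functions are strictly increasing in the multiplicity,
  `hypersurfaceHFe_mono_right/_injective`).
* §2 THE PRIME DICTIONARY of `B = R ⧸ (g₀)`: a point `𝔮 ∈ Spec B` ↦ `𝔮̃ = 𝔮 ∩ R` ↦ `Q = 𝔮̃ ∩ L[z,x]`, a prime `≤ 𝔪 = (z, x)`
  containing `g`; `Q = 𝔪 ⇔ 𝔮` is the closed point.
* §3 STALKS: `𝒪_{Spec B, 𝔮} ≅ B_𝔮 ≅ R_𝔮̃ ⧸ (g₀) ≅ L[z,x]_Q ⧸ (g)` (Mathlib's structure-sheaf localisation, W4.2's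
  `IdeasL1C4.exists_ringEquiv_localization_quotient`, localisation of a localisation), `L[z,x]_Q` regular local of
  dimension `ht Q ≤ 5`.
* §4 BENNETT (`hsFun_eq_hypersurfaceHFe_of_stalk_ringEquiv`): `H^N(𝔮) = hypersurfaceHFe (N+1) (m 𝔮)` with
  `m 𝔮` the order of `g` in `L[z,x]_Q`, read as a SYMBOLIC-POWER condition on `Q` (`CoeffDerivation` bridges):
  `m 𝔮 ≤ 3` by the ORDER CAP `SymbolicPower.hyp_not_mem_symbPow_succ` (`z³ + F` is nowhere `4`-fold), `m = 3` at the
  closed point (`hyp_mem_symbPow_idealOfVars`), and `m 𝔮 = 3 ⇒ Q = 𝔪` by the ISOLATION theorem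
  `SymbolicPower.eq_idealOfVars_of_hyp_mem_symbPow` (p665211: the easy half of Zariski–Nagata + `IsIsolated 3 F`).
* §5 TRANSFER `S ≅ Spec 𝒪_{S,s} ≅ Spec B` (`LocalChains.isIsolatedInHSMaxLocus_of_iso`), closed point ↦ `s`.

Def-free.  bears_on: LADDER-RESOLUTION:D157-DOOR2 (res-dim4-pi · F4-I(3,3) · row (I)).  Supports
stmt-ResolutionOfSingularities-16155 (helper).

## References

* V. Cossart, U. Jannsen, S. Saito, LNM 2270 (2020): Def. 2.28, Def. 2.35, Thm. 2.3 (Bennett), Def. 13.3.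
  [CossartJannsenSaito2020]
* H. Matsumura, Commutative Ring Theory (1986), §6 / Thm. 4.1 (symbolic powers). [Matsumura1987]
* The Stacks Project, Tag 01J7 (points of `Spec 𝒪_{X,x}`). [StacksProject]
-/

set_option linter.dupNamespace false -- mandated namespace of this single-conjunct summit

noncomputable section

open CategoryTheory AlgebraicGeometry TopologicalSpace IsLocalRing
open Literature.AlgebraicGeometry.Resolution Literature.RingTheory.HilbertSamuel
open Literature.AlgebraicGeometry.Resolution.Hauser2010
open Literature.AlgebraicGeometry.CossartJannsenSaito2020
open Literature.AlgebraicGeometry.Resolution.AffinePointBlowup (A P ξ)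
open Literature.AlgebraicGeometry.Hironaka2017.SpecOrders (Zs St)
open Summit.ResolutionOfSingularities.ResolutionOfSingularities.Theorems.SigmaMaxModificationsCorridor3
open Summit.ResolutionOfSingularities.ResolutionOfSingularities.Theorems.SigmaMaxModificationsCorridor3.Helpers
  (hypersurfaceHFe hypersurfaceHFe_mono_right hypersurfaceHFe_injective hsFun_eq_hypersurfaceHFe_of_stalk_ringEquiv)
open Summit.ResolutionOfSingularities.ResolutionOfSingularities.Theorems.SigmaMaxModificationsCorridor3.Moving.LocalChains
  (isIsolatedInHSMaxLocus_of_iso specializes_of_isLocalAt)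
open Summit.ResolutionOfSingularities.ResolutionOfSingularities.Cruxes.SigmaMaxModifications.IdeasL1C4
  (exists_ringEquiv_localization_quotient)

universe u

namespace Summit.ResolutionOfSingularities.ResolutionOfSingularities.Theorems.PIDim4

namespace E2OfCJS

namespace Isolation

/-! ## §1 An order profile peaked at one point isolates it in the Hilbert–Samuel locus -/

/-- **ORDER PROFILE ⇒ ISOLATION.**  On a locally Noetherian scheme `X`, suppose the Hilbert–Samuel function of
every point `y` is a hypersurface function `hypersurfaceHFe (N+1) (m y)`, with `m y ≤ m x` everywhere and
`m y = m x` only at `y = x`.  Then `X_max = {x}`, so `x` is isolated in the Hilbert–Samuel locus (with the open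
set `X` itself): the hypersurface functions increase strictly with the multiplicity.
[cite: CossartJannsenSaito2020, Def. 2.35, Def. 13.3] -/
theorem isIsolatedInHSMaxLocus_of_profile {X : Scheme.{u}} [IsLocallyNoetherian X] {N : ℕ} {x : X}
    (m : X → ℕ) (hm : ∀ y, Scheme.hsFun X N y = hypersurfaceHFe (N + 1) (m y))
    (hle : ∀ y, m y ≤ m x) (heq : ∀ y, m y = m x → y = x) : IsIsolatedInHSMaxLocus X N x := by
  refine ⟨Set.univ, isOpen_univ, ?_⟩
  ext y
  simp only [Set.mem_inter_iff, Set.mem_univ, true_and, Set.mem_singleton_iff, Scheme.mem_hsMaxLocus_iff]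
  constructor
  · intro hy
    apply heq
    have h1 : Scheme.hsFun X N y ≤ Scheme.hsFun X N x := by
      rw [hm y, hm x]; exact hypersurfaceHFe_mono_right _ (hle y)
    have h2 : Scheme.hsFun X N x ≤ Scheme.hsFun X N y := hy.2 ⟨x, rfl⟩ h1
    have h3 : Scheme.hsFun X N y = Scheme.hsFun X N x := le_antisymm h1 h2
    rw [hm y, hm x] at h3
    exact hypersurfaceHFe_injective (Nat.succ_pos N) h3
  · rintro rfl
    refine ⟨⟨y, rfl⟩, ?_⟩
    rintro v ⟨z, rfl⟩ -
    rw [hm z, hm y]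
    exact hypersurfaceHFe_mono_right _ (hle z)

/-! ## §2 The prime dictionary of `𝒪_{𝔸⁵,0} ⧸ (g₀)` -/

variable {L : Type} [Field L]

/-- The ideal of the variables of `L[z, x₁, …, x₄]` is the origin's prime `(ξ 4 L).asIdeal`. [folklore] -/
theorem idealOfVars_eq_ξ : MvPolynomial.idealOfVars (Fin (4 + 1)) L = (ξ 4 L).asIdeal := by
  rw [Literature.RingTheory.MvPolynomial.idealOfVars_eq_ker_constantCoeff]; rfl

/-- `𝒪_{𝔸⁵,0} ⧸ (g₀)` is a local ring when `F(0) = 0`. [folklore] -/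
theorem isLocalRing_quot (F : MvPolynomial (Fin 4) L) (hF : MvPolynomial.constantCoeff F = 0) :
    IsLocalRing (originStalk L ⧸ Ideal.span {hypGerm L F}) :=
  haveI := nontrivial_originStalk_quot L F hF
  IsLocalRing.of_surjective' (Ideal.Quotient.mk _) Ideal.Quotient.mk_surjective

/-- The contraction `Q = 𝔮̃ ∩ L[z,x]` of a prime `𝔮̃` of `𝒪_{𝔸⁵,0}` lies under the origin: `Q ≤ (z, x₁, …, x₄)`.
[cite: Matsumura1987, Thm. 4.1 (primes of a localisation)] -/
theorem under_le_idealOfVars (𝔮 : Ideal (originStalk L)) [𝔮.IsPrime] :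
    𝔮.under (A 4 L) ≤ MvPolynomial.idealOfVars (Fin (4 + 1)) L := by
  rw [idealOfVars_eq_ξ, ← IsLocalization.AtPrime.under_maximalIdeal (originStalk L) (ξ 4 L).asIdeal]
  exact Ideal.comap_mono (IsLocalRing.le_maximalIdeal Ideal.IsPrime.ne_top')

/-- If the contraction of `𝔮̃` is the origin then `𝔮̃` is the maximal ideal of `𝒪_{𝔸⁵,0}`.
[cite: Matsumura1987, Thm. 4.1 (primes of a localisation)] -/
theorem eq_maximalIdeal_of_under_eq (𝔮 : Ideal (originStalk L)) [𝔮.IsPrime]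
    (h : 𝔮.under (A 4 L) = MvPolynomial.idealOfVars (Fin (4 + 1)) L) : 𝔮 = maximalIdeal (originStalk L) := by
  rw [← IsLocalization.map_under (ξ 4 L).asIdeal.primeCompl (originStalk L) 𝔮, h, idealOfVars_eq_ξ,
    IsLocalization.AtPrime.map_eq_maximalIdeal]

/-- The pull-back `𝔮̃` to `𝒪_{𝔸⁵,0}` of a prime `𝔮` of `𝒪_{𝔸⁵,0} ⧸ (g₀)` contains `g₀`. [folklore] -/
theorem hypGerm_mem_comap (F : MvPolynomial (Fin 4) L) (𝔮 : Ideal (originStalk L ⧸ Ideal.span {hypGerm L F})) :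
    hypGerm L F ∈ 𝔮.comap (Ideal.Quotient.mk (Ideal.span {hypGerm L F})) := by
  rw [Ideal.mem_comap, Ideal.Quotient.eq_zero_iff_mem.mpr (Ideal.subset_span (Set.mem_singleton _))]
  exact zero_mem _

/-- Hence `g = z³ + F` lies in the contraction `Q`. [folklore] -/
theorem hyp_mem_under (F : MvPolynomial (Fin 4) L) (𝔮 : Ideal (originStalk L ⧸ Ideal.span {hypGerm L F})) :
    hyp 3 F ∈ (𝔮.comap (Ideal.Quotient.mk (Ideal.span {hypGerm L F}))).under (A 4 L) :=
  hypGerm_mem_comap F 𝔮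

/-- **If the contraction is the origin, the point is the closed point** of `Spec (𝒪_{𝔸⁵,0} ⧸ (g₀))`.
[cite: StacksProject, Tag 01J7] -/
theorem eq_closedPoint_of_under_eq {F : MvPolynomial (Fin 4) L} (hF : MvPolynomial.constantCoeff F = 0)
    (𝔮 : Zs (originStalk L ⧸ Ideal.span {hypGerm L F}))
    (h : (𝔮.asIdeal.comap (Ideal.Quotient.mk (Ideal.span {hypGerm L F}))).under (A 4 L) =
      MvPolynomial.idealOfVars (Fin (4 + 1)) L) :
    haveI := isLocalRing_quot F hF
    𝔮 = closedPoint (originStalk L ⧸ Ideal.span {hypGerm L F}) := by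
  haveI := isLocalRing_quot F hF
  have h1 := eq_maximalIdeal_of_under_eq _ h
  have h2 : 𝔮.asIdeal = (maximalIdeal (originStalk L)).map (Ideal.Quotient.mk (Ideal.span {hypGerm L F})) := by
    rw [← h1, Ideal.map_comap_of_surjective _ Ideal.Quotient.mk_surjective]
  have h3 : 𝔮.asIdeal.IsMaximal := by
    rcases Ideal.map_eq_top_or_isMaximal_of_surjective (Ideal.Quotient.mk (Ideal.span {hypGerm L F}))
        Ideal.Quotient.mk_surjective (IsLocalRing.maximalIdeal.isMaximal (originStalk L)) with htop | hmax
    · exact absurd (h2.trans htop) Ideal.IsPrime.ne_top'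
    · rwa [← h2] at hmax
  exact PrimeSpectrum.ext (IsLocalRing.eq_maximalIdeal h3)

/-- **The closed point contracts to the origin.** [cite: StacksProject, Tag 01J7] -/
theorem under_closedPoint_eq {F : MvPolynomial (Fin 4) L} (hF : MvPolynomial.constantCoeff F = 0) :
    haveI := isLocalRing_quot F hF
    ((closedPoint (originStalk L ⧸ Ideal.span {hypGerm L F})).asIdeal.comap
        (Ideal.Quotient.mk (Ideal.span {hypGerm L F}))).under (A 4 L) =
      MvPolynomial.idealOfVars (Fin (4 + 1)) L := by
  haveI := isLocalRing_quot F hF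
  have h1 : (closedPoint (originStalk L ⧸ Ideal.span {hypGerm L F})).asIdeal.comap
      (Ideal.Quotient.mk (Ideal.span {hypGerm L F})) = maximalIdeal (originStalk L) := by
    haveI : (closedPoint (originStalk L ⧸ Ideal.span {hypGerm L F})).asIdeal.IsMaximal :=
      IsLocalRing.maximalIdeal.isMaximal _
    haveI : ((closedPoint (originStalk L ⧸ Ideal.span {hypGerm L F})).asIdeal.comap
        (Ideal.Quotient.mk (Ideal.span {hypGerm L F}))).IsMaximal :=
      Ideal.comap_isMaximal_of_surjective _ Ideal.Quotient.mk_surjective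
    exact IsLocalRing.eq_maximalIdeal inferInstance
  rw [h1, IsLocalization.AtPrime.under_maximalIdeal (originStalk L) (ξ 4 L).asIdeal, idealOfVars_eq_ξ]

/-! ## §3 The stalks of `Spec (𝒪_{𝔸⁵,0} ⧸ (g₀))` are the hypersurface rings `L[z,x]_Q ⧸ (g)` -/

/-- The stalk of `Spec B` at a prime `𝔮` is the localisation `B_𝔮` (Mathlib's structure sheaf).
[cite: StacksProject, Tag 01J7] -/
theorem nonempty_stalk_ringEquiv_localization (B : Type) [CommRing B] (𝔮 : Zs B) :
    Nonempty (St B 𝔮 ≃+* Localization.AtPrime 𝔮.asIdeal) :=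
  ⟨(IsLocalization.algEquiv 𝔮.asIdeal.primeCompl (St B 𝔮) (Localization.AtPrime 𝔮.asIdeal)).toRingEquiv⟩

/-- **Localisation of a localisation**: for a prime `𝔮̃` of `R = 𝒪_{𝔸⁵,0} = L[z,x]_{(z,x)}`,
`R_𝔮̃ ≅ L[z,x]_Q` as `L[z,x]`-algebras, `Q = 𝔮̃ ∩ L[z,x]`. [cite: Matsumura1987, Thm. 4.1 (localisation of a localisation)] -/
theorem nonempty_algEquiv_localization_under (𝔮 : Ideal (originStalk L)) [𝔮.IsPrime] :
    Nonempty (Localization.AtPrime 𝔮 ≃ₐ[A 4 L] Localization.AtPrime (𝔮.under (A 4 L))) := by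
  haveI : IsLocalization.AtPrime (Localization.AtPrime 𝔮) (𝔮.under (A 4 L)) :=
    IsLocalization.isLocalization_isLocalization_atPrime_isLocalization (ξ 4 L).asIdeal.primeCompl
      (Localization.AtPrime 𝔮) 𝔮
  exact ⟨IsLocalization.algEquiv (𝔮.under (A 4 L)).primeCompl _ _⟩

/-- The extension of `(g₀)` to `R_𝔮̃` is generated by the image of `g = z³ + F`. [folklore] -/
theorem map_span_hypGerm (F : MvPolynomial (Fin 4) L) (𝔮 : Ideal (originStalk L)) [𝔮.IsPrime] :
    (Ideal.span {hypGerm L F}).map (algebraMap (originStalk L) (Localization.AtPrime 𝔮)) =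
      Ideal.span {algebraMap (A 4 L) (Localization.AtPrime 𝔮) (hyp 3 F)} := by
  rw [Ideal.map_span, Set.image_singleton, hypGerm, ← IsScalarTower.algebraMap_apply]

/-- An `L[z,x]`-algebra isomorphism carries `(g)` to `(g)`. [folklore] -/
theorem span_algebraMap_hyp_eq_map (F : MvPolynomial (Fin 4) L) (𝔮 : Ideal (originStalk L)) [𝔮.IsPrime]
    (ε : Localization.AtPrime 𝔮 ≃ₐ[A 4 L] Localization.AtPrime (𝔮.under (A 4 L))) :
    Ideal.span {algebraMap (A 4 L) (Localization.AtPrime (𝔮.under (A 4 L))) (hyp 3 F)} =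
      (Ideal.span {algebraMap (A 4 L) (Localization.AtPrime 𝔮) (hyp 3 F)}).map
        (ε.toRingEquiv : Localization.AtPrime 𝔮 →+* Localization.AtPrime (𝔮.under (A 4 L))) := by
  rw [Ideal.map_span, Set.image_singleton]
  congr 2
  exact (ε.commutes (hyp 3 F)).symm

/-- **`𝒪_{Spec B, 𝔮} ≅ L[z,x]_Q ⧸ (z³ + F)`** for `B = 𝒪_{𝔸⁵,0} ⧸ (g₀)` and `Q` the contraction of `𝔮`: the stalk is
`B_𝔮` (structure sheaf), `B_𝔮 ≅ R_𝔮̃ ⧸ (g₀)` (localisation commutes with quotients, W4.2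
`IdeasL1C4.exists_ringEquiv_localization_quotient`), and `R_𝔮̃ ≅ L[z,x]_Q` since `R = 𝒪_{𝔸⁵,0}` is itself the
localisation of `L[z,x]` at the origin. [cite: StacksProject, Tag 01J7]
[cite: Matsumura1987, Thm. 4.1 (localisation of a localisation)] -/
theorem nonempty_stalk_ringEquiv (F : MvPolynomial (Fin 4) L) (𝔮 : Zs (originStalk L ⧸ Ideal.span {hypGerm L F})) :
    Nonempty (St (originStalk L ⧸ Ideal.span {hypGerm L F}) 𝔮 ≃+*
      Localization.AtPrime ((𝔮.asIdeal.comap (Ideal.Quotient.mk (Ideal.span {hypGerm L F}))).under (A 4 L)) ⧸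
        Ideal.span {algebraMap (A 4 L)
          (Localization.AtPrime ((𝔮.asIdeal.comap (Ideal.Quotient.mk (Ideal.span {hypGerm L F}))).under (A 4 L)))
          (hyp 3 F)}) := by
  obtain ⟨ε₁⟩ := nonempty_stalk_ringEquiv_localization (originStalk L ⧸ Ideal.span {hypGerm L F}) 𝔮
  obtain ⟨ε₂⟩ := exists_ringEquiv_localization_quotient (Ideal.span {hypGerm L F}) 𝔮.asIdeal
    (𝔮.asIdeal.comap (Ideal.Quotient.mk (Ideal.span {hypGerm L F}))) rfl
  obtain ⟨ε₃⟩ := nonempty_algEquiv_localization_under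
    (𝔮.asIdeal.comap (Ideal.Quotient.mk (Ideal.span {hypGerm L F})))
  have hI := map_span_hypGerm F (𝔮.asIdeal.comap (Ideal.Quotient.mk (Ideal.span {hypGerm L F})))
  have hJ := span_algebraMap_hyp_eq_map F (𝔮.asIdeal.comap (Ideal.Quotient.mk (Ideal.span {hypGerm L F}))) ε₃
  exact ⟨ε₁.trans (ε₂.symm.trans ((Ideal.quotEquivOfEq hI).trans (Ideal.quotientEquiv _ _ ε₃.toRingEquiv hJ)))⟩

/-- `dim L[z,x]_Q = ht Q ≤ 5` for a prime `Q` under the origin (the origin's local ring has dimension `5`).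
[cite: Matsumura1987, §5 (ht P = dim A_P)] -/
theorem exists_ringKrullDim_eq (Q : Ideal (A 4 L)) [Q.IsPrime] (hQ : Q ≤ MvPolynomial.idealOfVars (Fin (4 + 1)) L) :
    ∃ e : ℕ, e ≤ 5 ∧ ringKrullDim (Localization.AtPrime Q) = e := by
  have h5 : ((ξ 4 L).asIdeal).height = 5 := by
    have h := IsLocalization.AtPrime.ringKrullDim_eq_height (ξ 4 L).asIdeal (originStalk L)
    rw [ringKrullDim_originStalk] at h
    have h' : (((ξ 4 L).asIdeal.height : ℕ∞) : WithBot ℕ∞) = ((5 : ℕ∞) : WithBot ℕ∞) := h.symm.trans (by norm_cast)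
    exact WithBot.coe_injective h'
  have hle : Q.height ≤ 5 := by
    rw [← h5]; exact Ideal.height_mono (hQ.trans_eq idealOfVars_eq_ξ)
  have hne : Q.height ≠ ⊤ := ne_top_of_le_ne_top (by decide) hle
  obtain ⟨e, he⟩ := ENat.ne_top_iff_exists.mp hne
  refine ⟨e, by exact_mod_cast he ▸ hle, ?_⟩
  rw [IsLocalization.AtPrime.ringKrullDim_eq_height Q (Localization.AtPrime Q), ← he]
  rfl

/-! ## §4 Bennett at every point of `Spec (𝒪_{𝔸⁵,0} ⧸ (g₀))`, in symbolic-power form -/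

/-- Symbolic powers of `Q ⊆ L[z,x]` are powers of the maximal ideal of `L[z,x]_Q` (the tree's `CoeffDerivation`
bridge, read for `HironakaScheme.symbPow`). [cite: Matsumura1987, Thm. 4.1 / §6 (symbolic powers)] -/
theorem mem_symbPow_iff_algebraMap_mem (Q : Ideal (A 4 L)) [Q.IsPrime] (f : A 4 L) (n : ℕ) :
    f ∈ HironakaScheme.symbPow L Q n ↔
      algebraMap (A 4 L) (Localization.AtPrime Q) f ∈ maximalIdeal (Localization.AtPrime Q) ^ n :=
  CoeffDerivation.exists_mul_mem_pow_iff_algebraMap_mem Q (Localization.AtPrime Q) f n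

/-- **The Hilbert–Samuel function at a point `𝔮` of `Spec (𝒪_{𝔸⁵,0} ⧸ (z³ + F))` is the hypersurface function
of the SYMBOLIC ORDER `m ∈ {1, 2, 3}` of `z³ + F` at the contracted prime `Q`** (`N ≥ 4`): Bennett
(`hsFun_eq_hypersurfaceHFe_of_stalk_ringEquiv`) on `𝒪_𝔮 ≅ L[z,x]_Q ⧸ (z³+F)`, with `m ≤ 3` by the ORDER CAP
(`SymbolicPower.hyp_not_mem_symbPow_succ`). [cite: CossartJannsenSaito2020, Def. 2.28, Thm. 2.3] -/
theorem exists_hsFun_eq (F : MvPolynomial (Fin 4) L) (𝔮 : Zs (originStalk L ⧸ Ideal.span {hypGerm L F}))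
    {N : ℕ} (hN : 4 ≤ N) :
    ∃ m : ℕ, Scheme.hsFun (Zs (originStalk L ⧸ Ideal.span {hypGerm L F})) N 𝔮 = hypersurfaceHFe (N + 1) m ∧
      m ≤ 3 ∧ hyp 3 F ∈ HironakaScheme.symbPow L
        ((𝔮.asIdeal.comap (Ideal.Quotient.mk (Ideal.span {hypGerm L F}))).under (A 4 L)) m ∧
      hyp 3 F ∉ HironakaScheme.symbPow L
        ((𝔮.asIdeal.comap (Ideal.Quotient.mk (Ideal.span {hypGerm L F}))).under (A 4 L)) (m + 1) := by
  set Q : Ideal (A 4 L) := (𝔮.asIdeal.comap (Ideal.Quotient.mk (Ideal.span {hypGerm L F}))).under (A 4 L)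
    with hQ
  obtain ⟨e, he5, he⟩ := exists_ringKrullDim_eq Q (under_le_idealOfVars _)
  obtain ⟨ε⟩ := nonempty_stalk_ringEquiv F 𝔮
  set g' : Localization.AtPrime Q := algebraMap (A 4 L) (Localization.AtPrime Q) (hyp 3 F) with hg'
  -- the order `m` of `g` in `L[z,x]_Q`: `1 ≤ m ≤ 3`
  have h1 : g' ∈ maximalIdeal (Localization.AtPrime Q) ^ 1 := by
    rw [pow_one]
    exact (IsLocalization.AtPrime.to_map_mem_maximal_iff (Localization.AtPrime Q) Q (hyp 3 F)).mpr
      (hyp_mem_under F 𝔮.asIdeal)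
  have h4 : g' ∉ maximalIdeal (Localization.AtPrime Q) ^ 4 := fun h =>
    SymbolicPower.hyp_not_mem_symbPow_succ (p := 3) (by norm_num) F (Q := Q)
      ((mem_symbPow_iff_algebraMap_mem Q (hyp 3 F) 4).mpr h)
  have key : ∃ m : ℕ, 1 ≤ m ∧ m ≤ 3 ∧ g' ∈ maximalIdeal (Localization.AtPrime Q) ^ m ∧
      g' ∉ maximalIdeal (Localization.AtPrime Q) ^ (m + 1) := by
    by_cases h2 : g' ∈ maximalIdeal (Localization.AtPrime Q) ^ 2
    · by_cases h3 : g' ∈ maximalIdeal (Localization.AtPrime Q) ^ 3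
      · exact ⟨3, by norm_num, le_rfl, h3, h4⟩
      · exact ⟨2, by norm_num, by norm_num, h2, h3⟩
    · exact ⟨1, le_rfl, by norm_num, h1, h2⟩
  obtain ⟨m, hm1, hm3, hgm, hgm'⟩ := key
  refine ⟨m, ?_, hm3, (mem_symbPow_iff_algebraMap_mem Q (hyp 3 F) m).mpr hgm,
    fun h => hgm' ((mem_symbPow_iff_algebraMap_mem Q (hyp 3 F) (m + 1)).mp h)⟩
  exact hsFun_eq_hypersurfaceHFe_of_stalk_ringEquiv he (by omega) hm1 hgm hgm' ε

/-! ## §5 Row (I) -/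

/-- **The closed point of `Spec (𝒪_{𝔸⁵,0} ⧸ (z³ + F))` is isolated in the Hilbert–Samuel locus** at every level
`N ≥ 4`, when `ordZero F = 3` and the origin is an ISOLATED `3`-fold point (`IsIsolated 3 F`): the order profile of
§4 peaks (value `3`) exactly at the closed point by `SymbolicPower.eq_idealOfVars_of_hyp_mem_symbPow`.
[cite: CossartJannsenSaito2020, Def. 13.3] -/
theorem isIsolatedInHSMaxLocus_closedPoint {F : MvPolynomial (Fin 4) L} (hF : ordZero F = (3 : ℕ∞))
    (hiso : IsIsolated 3 F) {N : ℕ} (hN : 4 ≤ N) :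
    haveI := isLocalRing_quot F (constantCoeff_eq_zero_of_ordZero_eq_three hF)
    IsIsolatedInHSMaxLocus (Zs (originStalk L ⧸ Ideal.span {hypGerm L F})) N
      (closedPoint (originStalk L ⧸ Ideal.span {hypGerm L F})) := by
  have hF0 := constantCoeff_eq_zero_of_ordZero_eq_three hF
  haveI := isLocalRing_quot F hF0
  choose m hm hm3 hsymb hsymb' using fun 𝔮 => exists_hsFun_eq F 𝔮 hN
  -- the closed point has order exactly `3`
  have hm0 : m (closedPoint _) = 3 := by
    refine le_antisymm (hm3 _) ?_
    by_contra hlt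
    push Not at hlt
    have h3 : hyp 3 F ∈ HironakaScheme.symbPow L (MvPolynomial.idealOfVars (Fin (4 + 1)) L) 3 :=
      SymbolicPower.hyp_mem_symbPow_idealOfVars (by rw [hF]; exact_mod_cast le_rfl)
    have hne := hsymb' (closedPoint _)
    rw [under_closedPoint_eq hF0] at hne
    exact hne (HironakaScheme.symbPow_mono (by omega) h3)
  refine isIsolatedInHSMaxLocus_of_profile m hm (fun 𝔮 => (hm3 𝔮).trans_eq hm0.symm) fun 𝔮 h𝔮 => ?_
  -- order `3` at `𝔮` forces the contraction to be the origin, i.e. `𝔮` to be the closed point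
  rw [hm0] at h𝔮
  have h3 := hsymb 𝔮
  rw [h𝔮] at h3
  exact eq_closedPoint_of_under_eq hF0 𝔮
    (SymbolicPower.eq_idealOfVars_of_hyp_mem_symbPow (p := 3) (by norm_num) hF0 hiso (under_le_idealOfVars _) h3)

/-- **ROW (I) `IsolationRow` DISCHARGED.**  For every local scheme `(S, s)` presented by `F` over a perfect field of
characteristic `3` with `ordZero F = 3` and `IsIsolated 3 F`, the closed point `s` is isolated in the
Hilbert–Samuel locus of `S` at every level `N ≥ 5` (indeed `≥ 4`): transfer of
`isIsolatedInHSMaxLocus_closedPoint` along `S ≅ Spec 𝒪_{S,s} ≅ Spec (𝒪_{𝔸⁵,0} ⧸ (g₀))`.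
[OURS · row I of the E2 transfer row] [cite: CossartJannsenSaito2020, Def. 13.3, p. 107] -/
theorem isolationRow_unfolded {L : Type} [Field L] {F : MvPolynomial (Fin 4) L} (hF : ordZero F = (3 : ℕ∞))
    (hiso : IsIsolated 3 F) {S : Scheme.{0}} [IsLocallyNoetherian S] {s : S} (hloc : IsLocalAt S s)
    (hpres : PresentedBy L F S s) {N : ℕ} (hN : 4 ≤ N) : IsIsolatedInHSMaxLocus S N s := by
  have hF0 := constantCoeff_eq_zero_of_ordZero_eq_three hF
  haveI := isLocalRing_quot F hF0
  obtain ⟨e⟩ := hpres.nonempty_ringEquiv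
  -- the isomorphism `S ⟶ Spec 𝒪_{S,s} ⟶ Spec (𝒪_{𝔸⁵,0} ⧸ (g₀))`
  haveI : IsIso (S.fromSpecStalk s) := hloc
  let φ : CommRingCat.of (originStalk L ⧸ Ideal.span {hypGerm L F}) ⟶ S.presheaf.stalk s :=
    CommRingCat.ofHom e.symm.toRingHom
  haveI : IsIso φ := by
    change IsIso e.symm.toCommRingCatIso.hom
    infer_instance
  let f : S ⟶ Zs (originStalk L ⧸ Ideal.span {hypGerm L F}) := inv (S.fromSpecStalk s) ≫ Spec.map φ
  refine isIsolatedInHSMaxLocus_of_iso f ?_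
  -- `f s` is the closed point: every point of `Spec B` specialises to it
  have hfs : f.base s = closedPoint (originStalk L ⧸ Ideal.span {hypGerm L F}) := by
    have hbij : Function.Bijective f.base := ConcreteCategory.bijective_of_isIso f.base
    obtain ⟨η, hη⟩ := hbij.2 (closedPoint _)
    have hsp : f.base η ⤳ f.base s := (specializes_of_isLocalAt hloc η).map f.base.hom.continuous
    rw [hη] at hsp
    have hcl : IsClosed ({closedPoint (originStalk L ⧸ Ideal.span {hypGerm L F})} :
        Set (Zs (originStalk L ⧸ Ideal.span {hypGerm L F}))) :=
      (PrimeSpectrum.isClosed_singleton_iff_isMaximal _).mpr (IsLocalRing.maximalIdeal.isMaximal _)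
    have hmem : f.base s ∈ closure {closedPoint (originStalk L ⧸ Ideal.span {hypGerm L F})} :=
      specializes_iff_mem_closure.mp hsp
    exact hcl.closure_subset_iff.mpr subset_rfl hmem
  rw [hfs]
  exact isIsolatedInHSMaxLocus_closedPoint hF hiso hN

end Isolation

/-- **ROW (I) OF THE E2 TRANSFER ROW — `IsolationRow` AS TYPED IN `…E2OfCJSRows` (p663940).** A LOCAL scheme presented
over a perfect field of characteristic `3` by `F` of residual order `3` with `IsIsolated 3 F` has its closed point
isolated in its Hilbert–Samuel locus at every level `N ≥ 5`. [OURS · row I of the E2 transfer row · counted 0]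
[cite: CossartJannsenSaito2020, Def. 13.3, p. 107] -/
theorem isolationRow : IsolationRow :=
  fun _L _ _ _ _F hF hiso _S _ _s hloc hpres _N hN =>
    Isolation.isolationRow_unfolded hF hiso hloc hpres (le_trans (by norm_num) hN)

end E2OfCJS

end Summit.ResolutionOfSingularities.ResolutionOfSingularities.Theorems.PIDim4

end
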